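import Literature.Computability.Cryptography.HILLAtoms
import Literature.Computability.Cryptography.HILLGreedySelection
import Literature.Computability.Cryptography.XorCombiner
import Literature.Computability.Complexity.LengthCompare
import HarnessLib

/-!
# HILL's distributions `𝒟^{(j)}`, `ℰ^{(j)}` of Lemma 6.3.2 as samplers on coin strings (Håstad–Impagliazzo–Levin–Luby 1999, §6.2–6.3)

HILL 1999 (SIAM J. Comput. 28; authors' preprint `galaxy-pdf--8752169249696178760`), §6.2 eq. (8) and §6.3:

> `g(pₙ, X', Y', I', R', U) = ⟨h'_U(⟨X'₁ ⊙ Y'₁, …, X'_{kₙ} ⊙ Y'_{kₙ}⟩), f'^{kₙ}(X', I', R'), U, Y'⟩` (8) …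
> `𝒟 = ⟨h'_U(…), f'^{kₙ}(X', I', R'), U, Y'⟩`, `ℰ = ⟨Z, f'^{kₙ}(X', I', R'), U, Y'⟩` … `𝒟^{(j−1)}_c(w_m)` [is] the same as
> `𝒟^{(j−1)}` except that `⟨X'ⱼ, I'ⱼ⟩` is fixed to `w_m` and the `j`th input bit of `h'` is set to `x̂_m ⊙ Y'ⱼ` if
> `c = 0`, `Bⱼ` if `c = 1` … `𝒟^{(j)}(w, r, b, y)` [is] `𝒟^{(j)}` except that `f'(X'_{j+1}, I'_{j+1}, R'_{j+1})` is set to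
> `f'(w, r)`, the `j+1`rst input bit of `h'` is set to `b` and `Y'_{j+1}` is set to `y`.

This file writes these distributions as deterministic functions of uniform coin strings (the format of the
tree's `uniformAvg` calculus and of the machines), in the `K = ⌊log₂ N⌋`-bit-block version of
`HILLAtoms.lean` (position `i` carries `w_i = x_i ‖ ι_i`, randomness `r_i`, `σ_i ∈ {0,1}^{K·N}` — HILL's `Y'_i` —
and the hidden block `GL_K(w_i, σ_i)` — HILL's `X'_i ⊙ Y'_i`):

* level data `HILL.GH.Params` (`kc`: `k = kc³` positions; `mlen N t`: the output length `m` of `h'` given the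
  advice `t`), per-position coin blocks `w ‖ r ‖ σ ‖ u` of length `cP N` (`u`: the fresh block used when the
  position's bit `c` is `1`);
* `posPub` / `posBlk`: the public part `g f (w‖r) ‖ σ` and the block of position `i` under a TEMPLATE `τ` of
  fixings `(w_i, c_i)` (positions `< |τ|` fixed; position `|τ|` optionally the challenge atom `z`; later
  positions fresh), `pubs` / `blocks` (all `k` positions), **`Dsample`** = `h'_U(blocks) ‖ pubs ‖ U` and
  **`Esample`** = `Z ‖ pubs ‖ U` (affine `h'` = `AffineStr.hashStr`, key `U`);
* the acceptance probabilities `accD`, `accE` of a distinguisher, the gap **`HILL.GH.delta`** (HILL's `δ^{(·)}`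
  as a function of the template) and the empirical estimator **`HILL.GH.estim`** (HILL's `Δ`), i.e. the
  concrete `δ`, `est` of `HILL.Greedy.Data`; basic facts (`|δ| ≤ 1`, lengths).

The `FP` programs computing these samplers, the estimator, the stages and the two-phase machine are the
next file; the laws (Fubini, Hoeffding, Lemma 4.5.1 on complete templates) the one after.

## References

* J. Håstad, R. Impagliazzo, L. A. Levin, M. Luby, SIAM J. Comput. 28 (1999): §6.2 eq. (4)–(8), Thm 6.2.1;
  §6.3 Lemma 6.3.2 (proof: the distributions `𝒟^{(j)}`, `ℰ^{(j)}`, `𝒟^{(j−1)}_c(w)`, `𝒟^{(j)}(w,r,b,y)`, the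
  estimate `Δ`).
-/

namespace Literature.Computability.Cryptography

open Finset _root_.Computability Complexity HCProd

namespace HILL

namespace GH

/-! ### Parameters and layout -/

/-- **Level parameters** of the construction: `kc N` (the number of positions is `k = kc³`, a perfect cube so
that `k^{2/3} = kc²` is integral) and the output length `mlen N t` of `h'` as a function of the level and the
advice `t`. [cite: HastadImpagliazzoLevinLuby1999, §6.2 eq. (4) (kₙ) and (6) (mₙ)] -/
structure Params where
  /-- cube root of the number of positions [cite: HastadImpagliazzoLevinLuby1999, §6.2 eq. (4)] -/
  kc : ℕ → ℕ
  /-- output length of `h'` given level and advice [cite: HastadImpagliazzoLevinLuby1999, §6.2 eq. (6)–(7)] -/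
  mlen : ℕ → ℕ → ℕ

namespace Params

variable (P : Params) (f : List Bool → List Bool)

/-- `k = kc³`: the number of positions. [cite: HastadImpagliazzoLevinLuby1999, §6.2 eq. (4)] -/
def kk (N : ℕ) : ℕ := P.kc N ^ 3

/-- Coins of one position: `w ‖ r ‖ σ ‖ u` (`N + rlen N + K·N + K`). [folklore] -/
def cP (N : ℕ) : ℕ := N + rlen N + kL N * N + kL N

/-- Length of the public part of a position: `|g f (w‖r)| + |σ| = Lg N + K·N`. [folklore] -/
def pubLen (N : ℕ) : ℕ := Lg N + kL N * N

/-- Length of the hash key `U`: `(k·K + 1)·m`. [cite: HastadImpagliazzoLevinLuby1999, Def. 4.4.2 (matrix hashing)] -/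
def uLen (N t : ℕ) : ℕ := (P.kk N * kL N + 1) * P.mlen N t

/-- Length of a sample of `𝒟`/`ℰ`: `m + k·pubLen + uLen`. [folklore] -/
def sLen (N t : ℕ) : ℕ := P.mlen N t + P.kk N * pubLen N + P.uLen N t

/-- The candidate slot `w` of a position's coins. [folklore] -/
def pcW (N : ℕ) (pc : List Bool) : List Bool := pc.take N
/-- The randomness `r` of a position's coins. [folklore] -/
def pcR (N : ℕ) (pc : List Bool) : List Bool := (pc.drop N).take (rlen N)
/-- The GL seed `σ` of a position's coins. [folklore] -/
def pcS (N : ℕ) (pc : List Bool) : List Bool := (pc.drop (N + rlen N)).take (kL N * N)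
/-- The fresh block `u` of a position's coins. [folklore] -/
def pcU (N : ℕ) (pc : List Bool) : List Bool := (pc.drop (N + rlen N + kL N * N)).take (kL N)

/-! ### Positions under a template -/

/-- **The public part of position `i`** under the template `τ`, with the challenge atom `z` planted at position
`|τ|` when `uc`: fixed positions use the template's `w_i` (fresh `r`, `σ`), the challenge position the atom's
public part, later positions are fresh. [cite: HastadImpagliazzoLevinLuby1999, Lemma 6.3.2 (proof: 𝒟^{(j)}, 𝒟^{(j)}(w,r,b,y))] -/
noncomputable def posPub (N : ℕ) (τ : List (List Bool × Bool)) (uc : Bool) (z : List Bool) (i : ℕ) (pc : List Bool) : List Bool :=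
  if i < τ.length then g f ((τ.getD i ([], false)).1 ++ pcR N pc) ++ pcS N pc
  else if uc ∧ i = τ.length then z.take (pubLen N)
  else g f (pcW N pc ++ pcR N pc) ++ pcS N pc

/-- **The block of position `i`**: at a fixed position the fresh `u` if `c_i = 1`, else `GL_K(w_i, σ)`; at the
challenge position the atom's block; at a fresh position `GL_K(w, σ)` with the fresh `w`.
[cite: HastadImpagliazzoLevinLuby1999, Lemma 6.3.2 (proof: "the j-th input bit of h' is set to x̂_m ⊙ Y'_j if c_j = 0, B_j if c_j = 1")] -/
def posBlk (N : ℕ) (τ : List (List Bool × Bool)) (uc : Bool) (z : List Bool) (i : ℕ) (pc : List Bool) : List Bool :=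
  if i < τ.length then (if (τ.getD i ([], false)).2 then pcU N pc else glBits (kL N) N (τ.getD i ([], false)).1 (pcS N pc))
  else if uc ∧ i = τ.length then z.drop (pubLen N)
  else glBits (kL N) N (pcW N pc) (pcS N pc)

/-- All public parts (positions `0, …, k−1`, coins `pcs` = `k` position blocks). [cite: HastadImpagliazzoLevinLuby1999, §6.2 eq. (8) (f'^{kₙ}(X',I',R'), Y')] -/
noncomputable def pubs (N : ℕ) (τ : List (List Bool × Bool)) (uc : Bool) (z pcs : List Bool) : List Bool :=
  ((List.range (P.kk N)).map fun i => posPub f N τ uc z i (Greedy.blkL (cP N) i pcs)).flatten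

/-- All blocks (the input of `h'`). [cite: HastadImpagliazzoLevinLuby1999, §6.2 eq. (8) (⟨X'₁ ⊙ Y'₁, …⟩)] -/
def blocks (N : ℕ) (τ : List (List Bool × Bool)) (uc : Bool) (z pcs : List Bool) : List Bool :=
  ((List.range (P.kk N)).map fun i => posBlk N τ uc z i (Greedy.blkL (cP N) i pcs)).flatten

/-- **A sample of `𝒟^{(τ)}`**: `h'_U(blocks) ‖ pubs ‖ U`. [cite: HastadImpagliazzoLevinLuby1999, §6.2 eq. (8) and Thm 6.2.1 (𝒟)] -/
noncomputable def Dsample (N t : ℕ) (τ : List (List Bool × Bool)) (uc : Bool) (z pcs U : List Bool) : List Bool :=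
  AffineStr.hashStr (P.kk N * kL N) (P.mlen N t) U (P.blocks N τ uc z pcs) ++ P.pubs f N τ uc z pcs ++ U

/-- **A sample of `ℰ^{(τ)}`**: `Z ‖ pubs ‖ U`. [cite: HastadImpagliazzoLevinLuby1999, Thm 6.2.1 (ℰ = ⟨Z, f'^{kₙ}, U, Y'⟩)] -/
noncomputable def Esample (N : ℕ) (τ : List (List Bool × Bool)) (uc : Bool) (z pcs U Z : List Bool) : List Bool :=
  Z ++ P.pubs f N τ uc z pcs ++ U

variable {P f}

/-- Length of a public part (length-preserving `f`, well-formed coins / atom). [folklore] -/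
theorem length_posPub (hlp : IsLengthPreserving f) {N : ℕ} {τ : List (List Bool × Bool)} (hτ : ∀ q ∈ τ, q.1.length = N)
    {uc : Bool} {z : List Bool} (hz : uc = true → z.length = La N) (i : ℕ) {pc : List Bool} (hpc : pc.length = cP N) :
    (posPub f N τ uc z i pc).length = pubLen N := by
  have hR : (pcR N pc).length = rlen N := by rw [pcR, List.length_take, List.length_drop, hpc, cP]; omega
  have hS : (pcS N pc).length = kL N * N := by rw [pcS, List.length_take, List.length_drop, hpc, cP]; omega
  have hW : (pcW N pc).length = N := by rw [pcW, List.length_take, hpc, cP]; omega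
  unfold posPub
  split_ifs with h1 h2
  · have hw : (τ.getD i ([], false)).1.length = N := by
      rw [List.getD_eq_getElem _ _ h1]; exact hτ _ (List.getElem_mem h1)
    rw [List.length_append, length_g hlp hw hR, hS, pubLen]
  · rw [List.length_take, hz h2.1, La, pubLen]; omega
  · rw [List.length_append, length_g hlp hW hR, hS, pubLen]

/-- Length of a block. [folklore] -/
theorem length_posBlk {N : ℕ} {τ : List (List Bool × Bool)} {uc : Bool} {z : List Bool} (hz : uc = true → z.length = La N)
    (i : ℕ) {pc : List Bool} (hpc : pc.length = cP N) : (posBlk N τ uc z i pc).length = kL N := by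
  have hU : (pcU N pc).length = kL N := by rw [pcU, List.length_take, List.length_drop, hpc, cP]; omega
  unfold posBlk
  split_ifs with h1 h2 h3
  · exact hU
  · exact length_glBits ..
  · rw [List.length_drop, hz h3.1, La, pubLen]; omega
  · exact length_glBits ..

/-- A block of a string of `k` blocks of length `L` has length `L`. [folklore] -/
theorem length_blkL {L k i : ℕ} {r : List Bool} (hr : r.length = k * L) (hi : i < k) : (Greedy.blkL L i r).length = L := by
  rw [Greedy.blkL, List.length_take, List.length_drop, hr]
  have : (i + 1) * L ≤ k * L := Nat.mul_le_mul_right _ hi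
  rw [Nat.succ_mul] at this
  omega

/-- Length of `pubs`. [folklore] -/
theorem length_pubs (hlp : IsLengthPreserving f) {N : ℕ} {τ : List (List Bool × Bool)} (hτ : ∀ q ∈ τ, q.1.length = N)
    {uc : Bool} {z : List Bool} (hz : uc = true → z.length = La N) {pcs : List Bool} (hpcs : pcs.length = P.kk N * cP N) :
    (P.pubs f N τ uc z pcs).length = P.kk N * pubLen N :=
  length_flatten_map_range fun i hi => length_posPub hlp hτ hz i (length_blkL hpcs hi)

/-- Length of `blocks`. [folklore] -/
theorem length_blocks {N : ℕ} {τ : List (List Bool × Bool)} {uc : Bool} {z : List Bool} (hz : uc = true → z.length = La N)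
    {pcs : List Bool} (hpcs : pcs.length = P.kk N * cP N) : (P.blocks N τ uc z pcs).length = P.kk N * kL N :=
  length_flatten_map_range fun i hi => length_posBlk hz i (length_blkL hpcs hi)

/-- **Length of a `𝒟`-sample.** [folklore] -/
theorem length_Dsample (hlp : IsLengthPreserving f) {N t : ℕ} {τ : List (List Bool × Bool)} (hτ : ∀ q ∈ τ, q.1.length = N)
    {uc : Bool} {z : List Bool} (hz : uc = true → z.length = La N) {pcs : List Bool} (hpcs : pcs.length = P.kk N * cP N)
    {U : List Bool} (hU : U.length = P.uLen N t) : (P.Dsample f N t τ uc z pcs U).length = P.sLen N t := by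
  rw [Dsample, List.length_append, List.length_append, AffineStr.length_hashStr, length_pubs hlp hτ hz hpcs, hU, sLen]

/-- **Length of an `ℰ`-sample.** [folklore] -/
theorem length_Esample (hlp : IsLengthPreserving f) {N t : ℕ} {τ : List (List Bool × Bool)} (hτ : ∀ q ∈ τ, q.1.length = N)
    {uc : Bool} {z : List Bool} (hz : uc = true → z.length = La N) {pcs : List Bool} (hpcs : pcs.length = P.kk N * cP N)
    {U : List Bool} (hU : U.length = P.uLen N t) {Z : List Bool} (hZ : Z.length = P.mlen N t) :
    (P.Esample f N τ uc z pcs U Z).length = P.sLen N t := by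
  rw [Esample, List.length_append, List.length_append, hZ, length_pubs hlp hτ hz hpcs, hU, sLen]

/-! ### Acceptance probabilities, the gap `δ`, the estimator `Δ` -/

variable (P f) (A : RandAlg (List Bool) Bool)

/-- `κ(N, t)`: `A`'s coin count on samples of level `N`, advice `t`. [folklore] -/
def κA (N t : ℕ) : ℕ := A.coinLen (2 * N + 2 + P.sLen N t)

/-- Coins of one `𝒟`-run: `pcs ‖ U ‖ (coins of A)`. [folklore] -/
def dTot (N t : ℕ) : ℕ := P.kk N * cP N + P.uLen N t + P.κA A N t
/-- Coins of one `ℰ`-run: `pcs ‖ U ‖ Z ‖ (coins of A)`. [folklore] -/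
def eTot (N t : ℕ) : ℕ := P.kk N * cP N + P.uLen N t + P.mlen N t + P.κA A N t

/-- The bit `A(1^N, 𝒟-sample)` as a function of the coins of one `𝒟`-run. [folklore] -/
noncomputable def runD (N t : ℕ) (τ : List (List Bool × Bool)) (uc : Bool) (z r : List Bool) : Bool :=
  A.run (boolPair (unaryEncodeNat N) (P.Dsample f N t τ uc z (r.take (P.kk N * cP N)) ((r.drop (P.kk N * cP N)).take (P.uLen N t))))
    (r.drop (P.kk N * cP N + P.uLen N t))

/-- The bit `A(1^N, ℰ-sample)` as a function of the coins of one `ℰ`-run. [folklore] -/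
noncomputable def runE (N t : ℕ) (τ : List (List Bool × Bool)) (uc : Bool) (z r : List Bool) : Bool :=
  A.run (boolPair (unaryEncodeNat N) (P.Esample f N τ uc z (r.take (P.kk N * cP N)) ((r.drop (P.kk N * cP N)).take (P.uLen N t))
      ((r.drop (P.kk N * cP N + P.uLen N t)).take (P.mlen N t))))
    (r.drop (P.kk N * cP N + P.uLen N t + P.mlen N t))

/-- `Pr[A(1^N, 𝒟^{(τ)}) = 1]` (no challenge). [cite: HastadImpagliazzoLevinLuby1999, Lemma 6.3.2 (proof: Pr[A(𝒟^{(j)}) = 1])] -/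
noncomputable def accD (N t : ℕ) (τ : List (List Bool × Bool)) : ℝ :=
  uniformAvg (P.dTot A N t) fun r => Greedy.ind (P.runD f A N t τ false [] r = true)

/-- `Pr[A(1^N, ℰ^{(τ)}) = 1]`. [cite: HastadImpagliazzoLevinLuby1999, Lemma 6.3.2 (proof: Pr[A(ℰ^{(j)}) = 1])] -/
noncomputable def accE (N t : ℕ) (τ : List (List Bool × Bool)) : ℝ :=
  uniformAvg (P.eTot A N t) fun r => Greedy.ind (P.runE f A N t τ false [] r = true)

/-- **HILL's `δ^{(τ)}`**: the gap of `A` between `𝒟^{(τ)}` and `ℰ^{(τ)}`, as a function of the template.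
[cite: HastadImpagliazzoLevinLuby1999, Lemma 6.3.2 (proof: δ^{(j)} = Pr[A(𝒟^{(j)}) = 1] − Pr[A(ℰ^{(j)}) = 1])] -/
noncomputable def delta (N t : ℕ) (τ : List (List Bool × Bool)) : ℝ := P.accD f A N t τ - P.accE f A N t τ

/-- Coins of one estimation sample: a `𝒟`-run and an `ℰ`-run. [folklore] -/
def cSamp (N t : ℕ) : ℕ := P.dTot A N t + P.eTot A N t

/-- **HILL's estimate `Δ`** of `δ(τ · (w, c))`: the empirical mean over `Ns` independent pairs of runs, read off
`Ns` coin blocks. [cite: HastadImpagliazzoLevinLuby1999, Lemma 6.3.2 (proof: "Using A and sampling O(n/ρ²) times … produce an estimate Δ")] -/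
noncomputable def estim (Ns N t : ℕ) (τ : List (List Bool × Bool)) (wc : List Bool × Bool) (ce : List Bool) : ℝ :=
  (∑ s ∈ Finset.range Ns,
      (Greedy.ind (P.runD f A N t (τ ++ [wc]) false [] ((Greedy.blkL (P.cSamp A N t) s ce).take (P.dTot A N t)) = true) -
        Greedy.ind (P.runE f A N t (τ ++ [wc]) false [] ((Greedy.blkL (P.cSamp A N t) s ce).drop (P.dTot A N t)) = true))) / Ns

variable {P f A}

/-- `0 ≤ accD ≤ 1`. [folklore] -/
theorem accD_mem (N t : ℕ) (τ : List (List Bool × Bool)) : 0 ≤ P.accD f A N t τ ∧ P.accD f A N t τ ≤ 1 :=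
  ⟨uniformAvg_nonneg fun _ => Greedy.ind_nonneg _, uniformAvg_le_one fun _ => by simp only [Greedy.ind]; split_ifs <;> norm_num⟩

/-- `0 ≤ accE ≤ 1`. [folklore] -/
theorem accE_mem (N t : ℕ) (τ : List (List Bool × Bool)) : 0 ≤ P.accE f A N t τ ∧ P.accE f A N t τ ≤ 1 :=
  ⟨uniformAvg_nonneg fun _ => Greedy.ind_nonneg _, uniformAvg_le_one fun _ => by simp only [Greedy.ind]; split_ifs <;> norm_num⟩

/-- **`|δ| ≤ 1`.** [folklore] -/
theorem abs_delta_le (N t : ℕ) (τ : List (List Bool × Bool)) : |P.delta f A N t τ| ≤ 1 := by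
  obtain ⟨h1, h2⟩ := accD_mem (P := P) (f := f) (A := A) N t τ
  obtain ⟨h3, h4⟩ := accE_mem (P := P) (f := f) (A := A) N t τ
  unfold delta; rw [abs_le]; constructor <;> linarith

/-! ### The encoded template -/

/-- **The template as a string**: the records `w_i ‖ [c_i]`. [folklore] -/
def encT (τ : List (List Bool × Bool)) : List Bool := (τ.map fun q => q.1 ++ [q.2]).flatten

/-- `encT (τ · (w, c)) = encT τ ‖ w ‖ [c]`. [folklore] -/
theorem encT_append (τ : List (List Bool × Bool)) (w : List Bool) (c : Bool) : encT (τ ++ [(w, c)]) = encT τ ++ (w ++ [c]) := by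
  simp [encT]

/-- Length of the encoded template. [folklore] -/
theorem length_encT {N : ℕ} {τ : List (List Bool × Bool)} (hτ : ∀ q ∈ τ, q.1.length = N) : (encT τ).length = τ.length * (N + 1) := by
  induction τ with
  | nil => simp [encT]
  | cons q τ ih =>
    have hq : q.1.length = N := hτ q List.mem_cons_self
    have ih' := ih fun q' hq' => hτ q' (List.mem_cons_of_mem _ hq')
    unfold encT at ih' ⊢
    simp only [List.map_cons, List.flatten_cons, List.length_append, List.length_cons, List.length_nil, hq]
    rw [ih']; ring

/-- **Record `i` of the encoded template** is `w_i ‖ [c_i]`. [folklore] -/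
theorem blkL_encT {N : ℕ} {τ : List (List Bool × Bool)} (hτ : ∀ q ∈ τ, q.1.length = N) {i : ℕ} (hi : i < τ.length) :
    Greedy.blkL (N + 1) i (encT τ) = (τ.getD i ([], false)).1 ++ [(τ.getD i ([], false)).2] := by
  have hbs : ∀ b ∈ τ.map (fun q => q.1 ++ [q.2]), b.length = N + 1 := by
    intro b hb
    rw [List.mem_map] at hb
    obtain ⟨q, hq, rfl⟩ := hb
    rw [List.length_append, hτ q hq, List.length_singleton]
  have h := blk_flatten_eq (τ.map fun q => q.1 ++ [q.2]) hbs i (by rw [List.length_map]; exact hi)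
  rw [encT, show Greedy.blkL (N + 1) i = Hybrid.blk (N + 1) i from rfl, h, List.getElem!_eq_getElem?_getD, List.getElem?_map,
    List.getD_eq_getElem?_getD]
  cases hτi : τ[i]? with
  | none => exact absurd hτi (by rw [List.getElem?_eq_getElem hi]; exact Option.some_ne_none _)
  | some q => rfl

/-! ### The `FP` programs of the samplers -/

section Program

open Complexity.Brick Complexity.Plumb Complexity.OracleCompose

variable (P f) (kcP : Polynomial ℕ) (mlenF : List Bool → List Bool)

/-! #### Accessors of the record `⟨X, 1ⁱ⟩`, `X = ⟨⟨1^N, 1^t⟩, ⟨tmpl, ⟨cz, ⟨pcs, ⟨U, Z⟩⟩⟩⟩⟩` -/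

/-- `X`. [folklore] -/
noncomputable def xF : List Bool → List Bool := fstF
/-- `1ⁱ`. [folklore] -/
noncomputable def iU : List Bool → List Bool := sndF
/-- `1^N`. [folklore] -/
noncomputable def NU : List Bool → List Bool := fstF ∘ fstF ∘ xF
/-- `1^t`. [folklore] -/
noncomputable def tU : List Bool → List Bool := sndF ∘ fstF ∘ xF
/-- `tmpl`. [folklore] -/
noncomputable def tmF : List Bool → List Bool := fstF ∘ sndF ∘ xF
/-- `[uc]`. [folklore] -/
noncomputable def ucF : List Bool → List Bool := fstF ∘ fstF ∘ sndF ∘ sndF ∘ xF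
/-- `z`. [folklore] -/
noncomputable def zF : List Bool → List Bool := sndF ∘ fstF ∘ sndF ∘ sndF ∘ xF
/-- `pcs`. [folklore] -/
noncomputable def pcsF : List Bool → List Bool := fstF ∘ sndF ∘ sndF ∘ sndF ∘ xF
/-- `1^{rlen N}`. [folklore] -/
noncomputable def rlU : List Bool → List Bool := polyFn R0 ∘ NU
/-- `1^K`. [folklore] -/
noncomputable def KKU : List Bool → List Bool := logFn ∘ NU
/-- `1^{K·N}`. [folklore] -/
noncomputable def KNU : List Bool → List Bool := HashBricks.umulFn ∘ fanoutFn KKU NU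
/-- `1^{N + rlen N}`. [folklore] -/
noncomputable def NrU : List Bool → List Bool := concatFn ∘ fanoutFn NU rlU
/-- `1^{N + rlen N + K·N}`. [folklore] -/
noncomputable def NrKU : List Bool → List Bool := concatFn ∘ fanoutFn NrU KNU
/-- `1^{cP N}`. [folklore] -/
noncomputable def cPU : List Bool → List Bool := concatFn ∘ fanoutFn NrKU KKU
/-- `1^{N+1}`. [folklore] -/
noncomputable def n1U : List Bool → List Bool := List.cons true ∘ NU
/-- `1^{pubLen N}` (via a run of `G2` on the zero seed, `HILL.LgU`). [folklore] -/
noncomputable def pLU : List Bool → List Bool := concatFn ∘ fanoutFn (LgU f ∘ fanoutFn NU NU) KNU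
/-- The coins of position `i`: `blkL cP i pcs`. [folklore] -/
noncomputable def pcF : List Bool → List Bool := takeFn ∘ fanoutFn cPU (dropFn ∘ fanoutFn (HashBricks.umulFn ∘ fanoutFn iU cPU) pcsF)
/-- Record `i` of the template. [folklore] -/
noncomputable def recF : List Bool → List Bool := takeFn ∘ fanoutFn n1U (dropFn ∘ fanoutFn (HashBricks.umulFn ∘ fanoutFn iU n1U) tmF)
/-- `[(i+1)(N+1) ≤ |tmpl|]` — position `i` is fixed. [folklore] -/
noncomputable def fixedF : List Bool → List Bool :=
  lenLeFn Polynomial.X ∘ fanoutFn tmF (HashBricks.umulFn ∘ fanoutFn (List.cons true ∘ iU) n1U)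
/-- `[i(N+1) ≤ |tmpl|]`. [folklore] -/
noncomputable def le1F : List Bool → List Bool := lenLeFn Polynomial.X ∘ fanoutFn tmF (HashBricks.umulFn ∘ fanoutFn iU n1U)
/-- `[|tmpl| ≤ i(N+1)]`. [folklore] -/
noncomputable def le2F : List Bool → List Bool := lenLeFn Polynomial.X ∘ fanoutFn (HashBricks.umulFn ∘ fanoutFn iU n1U) tmF
/-- `[uc ∧ i = |τ|]` — position `i` is the challenge position. [folklore] -/
noncomputable def chalF : List Bool → List Bool := iteFn le1F (iteFn le2F ucF (fun _ => [false])) (fun _ => [false])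
/-- `w_i` of the record. [folklore] -/
noncomputable def recWF : List Bool → List Bool := takeFn ∘ fanoutFn NU recF
/-- `[c_i]` of the record. [folklore] -/
noncomputable def recCF : List Bool → List Bool := dropFn ∘ fanoutFn NU recF
/-- `r` of the position's coins. [folklore] -/
noncomputable def prF : List Bool → List Bool := takeFn ∘ fanoutFn rlU (dropFn ∘ fanoutFn NU pcF)
/-- `σ` of the position's coins. [folklore] -/
noncomputable def psF : List Bool → List Bool := takeFn ∘ fanoutFn KNU (dropFn ∘ fanoutFn NrU pcF)
/-- `u` of the position's coins. [folklore] -/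
noncomputable def puF : List Bool → List Bool := takeFn ∘ fanoutFn KKU (dropFn ∘ fanoutFn NrKU pcF)
/-- `w` (candidate slot) of the position's coins. [folklore] -/
noncomputable def pwF : List Bool → List Bool := takeFn ∘ fanoutFn NU pcF
/-- `g f (w ‖ r)` for a given `w`-accessor. [folklore] -/
noncomputable def gOf (w : List Bool → List Bool) : List Bool → List Bool := gPF f ∘ fanoutFn NU (fanoutFn w prF)
/-- `GL_K(w, σ)` for a given `w`-accessor. [folklore] -/
noncomputable def glOf (w : List Bool → List Bool) : List Bool → List Bool := glbF ∘ fanoutFn NU (fanoutFn w psF)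
/-- **The public-part piece** `⟨X, 1ⁱ⟩ ↦ posPub`. [cite: HastadImpagliazzoLevinLuby1999, Lemma 6.3.2 (proof: 𝒟^{(j)})] -/
noncomputable def piecePub : List Bool → List Bool :=
  iteFn fixedF (concatFn ∘ fanoutFn (gOf f recWF) psF)
    (iteFn (chalF) (takeFn ∘ fanoutFn (pLU f) zF) (concatFn ∘ fanoutFn (gOf f pwF) psF))
/-- **The block piece** `⟨X, 1ⁱ⟩ ↦ posBlk`. [cite: HastadImpagliazzoLevinLuby1999, Lemma 6.3.2 (proof: "the j-th input bit of h'")] -/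
noncomputable def pieceBlk : List Bool → List Bool :=
  iteFn fixedF (iteFn recCF puF (glOf recWF)) (iteFn chalF (dropFn ∘ fanoutFn (pLU f) zF) (glOf pwF))

variable {P f kcP mlenF}

/-- `|1ⁿ| = n`. [folklore] -/
private theorem length_unary (n : ℕ) : (unaryEncodeNat n).length = n := unary_decode_encode_nat n

/-- **A well-formed sampler record** of level `N`, advice `t`, template `τ`, challenge data `uc, z`, position coins
`pcs` and the rest `U, Z`. [folklore] -/
def srec (N t : ℕ) (τ : List (List Bool × Bool)) (uc : Bool) (z pcs U Z : List Bool) : List Bool :=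
  boolPair (boolPair (unaryEncodeNat N) (unaryEncodeNat t))
    (boolPair (encT τ) (boolPair (boolPair [uc] z) (boolPair pcs (boolPair U Z))))

/-- Values of the accessors and unary helpers on `⟨rec, 1ⁱ⟩`. [folklore] -/
theorem units_srec (N t : ℕ) (τ : List (List Bool × Bool)) (uc : Bool) (z pcs U Z : List Bool) (i : ℕ) :
    let w := boolPair (srec N t τ uc z pcs U Z) (ones i)
    NU w = unaryEncodeNat N ∧ tU w = unaryEncodeNat t ∧ tmF w = encT τ ∧ ucF w = [uc] ∧ zF w = z ∧ pcsF w = pcs ∧ iU w = ones i ∧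
      rlU w = ones (rlen N) ∧ KKU w = ones (kL N) ∧ KNU w = ones (kL N * N) ∧ NrU w = ones (N + rlen N) ∧
      NrKU w = ones (N + rlen N + kL N * N) ∧ cPU w = ones (cP N) ∧ n1U w = ones (N + 1) := by
  intro w
  have hN := length_unary N
  have h1 : NU w = unaryEncodeNat N := by simp [w, NU, xF, srec]
  have h2 : tU w = unaryEncodeNat t := by simp [w, tU, xF, srec]
  have h3 : tmF w = encT τ := by simp [w, tmF, xF, srec]
  have h4 : ucF w = [uc] := by simp [w, ucF, xF, srec]
  have h5 : zF w = z := by simp [w, zF, xF, srec]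
  have h6 : pcsF w = pcs := by simp [w, pcsF, xF, srec]
  have h7 : iU w = ones i := by simp [w, iU]
  have h8 : rlU w = ones (rlen N) := by rw [rlU, Function.comp_apply, h1, polyFn_apply, hN, R0_eval]
  have h9 : KKU w = ones (kL N) := by rw [KKU, Function.comp_apply, h1, logFn, hN, kL]
  have h10 : KNU w = ones (kL N * N) := by
    rw [KNU, Function.comp_apply, fanoutFn_apply, h9, h1, HashBricks.umulFn_apply, fstF_boolPair, sndF_boolPair, hN]
    simp [ones]
  have hu : unaryEncodeNat N = ones N := by simp [ones, Complexity.unaryEncodeNat_eq_replicate]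
  have h11 : NrU w = ones (N + rlen N) := by
    rw [NrU, Function.comp_apply, fanoutFn_apply, h1, h8, concatFn_boolPair, hu, Com.ones_append]
  have h12 : NrKU w = ones (N + rlen N + kL N * N) := by
    rw [NrKU, Function.comp_apply, fanoutFn_apply, h11, h10, concatFn_boolPair, Com.ones_append]
  have h13 : cPU w = ones (cP N) := by
    rw [cPU, Function.comp_apply, fanoutFn_apply, h12, h9, concatFn_boolPair, Com.ones_append, cP]
  have h14 : n1U w = ones (N + 1) := by
    rw [n1U, Function.comp_apply, h1, hu, ones, ones, List.replicate_succ]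
  exact ⟨h1, h2, h3, h4, h5, h6, h7, h8, h9, h10, h11, h12, h13, h14⟩

set_option maxHeartbeats 800000 in
/-- Values of the position-level accessors on `⟨srec, 1ⁱ⟩` (`i < k`, well-formed coins). [folklore] -/
theorem slices_srec {N t : ℕ} {τ : List (List Bool × Bool)} (hτ : ∀ q ∈ τ, q.1.length = N) (uc : Bool) (z : List Bool)
    {pcs : List Bool} (U Z : List Bool) (i : ℕ) :
    let w := boolPair (srec N t τ uc z pcs U Z) (ones i)
    let pc := Greedy.blkL (cP N) i pcs
    pcF w = pc ∧ recF w = Greedy.blkL (N + 1) i (encT τ) ∧ fixedF w = [decide (i < τ.length)] ∧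
      chalF w = [decide (uc = true ∧ i = τ.length)] ∧ prF w = pcR N pc ∧ psF w = pcS N pc ∧ puF w = pcU N pc ∧ pwF w = pcW N pc := by
  intro w pc
  obtain ⟨h1, -, h3, h4, -, h6, h7, h8, h9, h10, h11, h12, h13, h14⟩ := units_srec N t τ uc z pcs U Z i
  have hτl : (encT τ).length = τ.length * (N + 1) := length_encT hτ
  have hpc : pcF w = pc := by
    rw [pcF, Function.comp_apply, fanoutFn_apply, h13, Function.comp_apply, fanoutFn_apply, Function.comp_apply, fanoutFn_apply, h7, h13,
      HashBricks.umulFn_apply, fstF_boolPair, sndF_boolPair, h6, dropFn_boolPair, takeFn_boolPair]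
    simp [ones, pc, Greedy.blkL]
  have hrec : recF w = Greedy.blkL (N + 1) i (encT τ) := by
    rw [recF, Function.comp_apply, fanoutFn_apply, h14, Function.comp_apply, fanoutFn_apply, Function.comp_apply, fanoutFn_apply, h7, h14,
      HashBricks.umulFn_apply, fstF_boolPair, sndF_boolPair, h3, dropFn_boolPair, takeFn_boolPair]
    simp [ones, Greedy.blkL]
  have hfix : fixedF w = [decide (i < τ.length)] := by
    rw [fixedF, Function.comp_apply, fanoutFn_apply, h3, Function.comp_apply, fanoutFn_apply, Function.comp_apply, h7, h14,
      HashBricks.umulFn_apply, fstF_boolPair, sndF_boolPair, lenLeFn_boolPair, Polynomial.eval_X, hτl]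
    simp only [ones, List.length_cons, List.length_replicate]
    exact congrArg (fun b => [b]) (decide_eq_decide.2
      ⟨fun h => Nat.lt_of_succ_le (Nat.le_of_mul_le_mul_right h (Nat.succ_pos N)),
       fun h => Nat.mul_le_mul_right (N + 1) (Nat.succ_le_of_lt h)⟩)
  have hle1 : le1F w = [decide (i ≤ τ.length)] := by
    rw [le1F, Function.comp_apply, fanoutFn_apply, h3, Function.comp_apply, fanoutFn_apply, h7, h14, HashBricks.umulFn_apply,
      fstF_boolPair, sndF_boolPair, lenLeFn_boolPair, Polynomial.eval_X, hτl]
    simp only [ones, List.length_replicate]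
    exact congrArg (fun b => [b]) (decide_eq_decide.2
      ⟨fun h => Nat.le_of_mul_le_mul_right h (Nat.succ_pos N), fun h => Nat.mul_le_mul_right _ h⟩)
  have hle2 : le2F w = [decide (τ.length ≤ i)] := by
    rw [le2F, Function.comp_apply, fanoutFn_apply, Function.comp_apply, fanoutFn_apply, h7, h14, HashBricks.umulFn_apply,
      fstF_boolPair, sndF_boolPair, h3, lenLeFn_boolPair, Polynomial.eval_X, hτl]
    simp only [ones, List.length_replicate]
    exact congrArg (fun b => [b]) (decide_eq_decide.2
      ⟨fun h => Nat.le_of_mul_le_mul_right h (Nat.succ_pos N), fun h => Nat.mul_le_mul_right _ h⟩)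
  have hchal : chalF w = [decide (uc = true ∧ i = τ.length)] := by
    rw [chalF, iteFn_apply hle1]
    by_cases hi1 : i ≤ τ.length
    · rw [decide_eq_true hi1, if_pos rfl, iteFn_apply hle2]
      by_cases hi2 : τ.length ≤ i
      · rw [decide_eq_true hi2, if_pos rfl, h4]
        have hieq : i = τ.length := le_antisymm hi1 hi2
        cases uc <;> simp [hieq]
      · rw [decide_eq_false hi2]
        simp only [Bool.false_eq_true, ↓reduceIte]
        have : ¬ (uc = true ∧ i = τ.length) := fun h => hi2 h.2.ge
        rw [decide_eq_false this]
    · rw [decide_eq_false hi1]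
      simp only [Bool.false_eq_true, ↓reduceIte]
      have : ¬ (uc = true ∧ i = τ.length) := fun h => hi1 h.2.le
      rw [decide_eq_false this]
  have hpr : prF w = pcR N pc := by
    rw [prF, Function.comp_apply, fanoutFn_apply, h8, Function.comp_apply, fanoutFn_apply, h1, hpc, dropFn_boolPair, takeFn_boolPair,
      length_unary, pcR]; simp [ones]
  have hps : psF w = pcS N pc := by
    rw [psF, Function.comp_apply, fanoutFn_apply, h10, Function.comp_apply, fanoutFn_apply, h11, hpc, dropFn_boolPair, takeFn_boolPair, pcS]
    simp [ones]
  have hpu : puF w = pcU N pc := by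
    rw [puF, Function.comp_apply, fanoutFn_apply, h9, Function.comp_apply, fanoutFn_apply, h12, hpc, dropFn_boolPair, takeFn_boolPair, pcU]
    simp [ones]
  have hpw : pwF w = pcW N pc := by
    rw [pwF, Function.comp_apply, fanoutFn_apply, h1, hpc, takeFn_boolPair, length_unary, pcW]
  exact ⟨hpc, hrec, hfix, hchal, hpr, hps, hpu, hpw⟩

/-- **Value of the public-part piece** on a well-formed record: `posPub`. [folklore] -/
theorem piecePub_apply (hlp : IsLengthPreserving f) {N t : ℕ} {τ : List (List Bool × Bool)} (hτ : ∀ q ∈ τ, q.1.length = N)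
    (uc : Bool) (z : List Bool) {pcs : List Bool} (hpcs : pcs.length = P.kk N * cP N) (U Z : List Bool) {i : ℕ} (hi : i < P.kk N) :
    piecePub f (boolPair (srec N t τ uc z pcs U Z) (ones i)) = posPub f N τ uc z i (Greedy.blkL (cP N) i pcs) := by
  set w := boolPair (srec N t τ uc z pcs U Z) (ones i) with hw
  obtain ⟨h1, -, -, -, h5, -, -, -, -, h10, -⟩ := units_srec N t τ uc z pcs U Z i
  obtain ⟨hpc, hrec, hfix, hchal, hpr, hps, hpu, hpw⟩ := slices_srec (t := t) hτ uc z (pcs := pcs) U Z i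
  have hpcl : (Greedy.blkL (cP N) i pcs).length = cP N := length_blkL hpcs hi
  have hRlen : (pcR N (Greedy.blkL (cP N) i pcs)).length = rlen N := by
    rw [pcR, List.length_take, List.length_drop, hpcl, cP]; omega
  have hWlen : (pcW N (Greedy.blkL (cP N) i pcs)).length = N := by rw [pcW, List.length_take, hpcl, cP]; omega
  have hpLU : pLU f w = ones (pubLen N) := by
    rw [pLU, Function.comp_apply, fanoutFn_apply, Function.comp_apply, fanoutFn_apply, h1, LgU_apply hlp, h10, concatFn_boolPair,
      Com.ones_append, pubLen]
  rw [piecePub, iteFn_apply hfix]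
  by_cases hlt : i < τ.length
  · rw [decide_eq_true hlt, if_pos rfl, Function.comp_apply, fanoutFn_apply, gOf, Function.comp_apply, fanoutFn_apply, fanoutFn_apply,
      h1, recWF, Function.comp_apply, fanoutFn_apply, h1, hrec, takeFn_boolPair, length_unary, hpr, hps, posPub, if_pos hlt,
      blkL_encT hτ hlt]
    have hwl : (τ.getD i ([], false)).1.length = N := by
      rw [List.getD_eq_getElem _ _ hlt]; exact hτ _ (List.getElem_mem hlt)
    rw [List.take_append_of_le_length hwl.ge, List.take_of_length_le hwl.le, gPF_apply hwl hRlen, concatFn_boolPair]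
  · rw [decide_eq_false hlt]
    simp only [Bool.false_eq_true, ↓reduceIte]
    rw [iteFn_apply hchal, posPub, if_neg hlt]
    by_cases hch : uc = true ∧ i = τ.length
    · rw [decide_eq_true hch, if_pos rfl, if_pos hch, Function.comp_apply, fanoutFn_apply, hpLU, h5, takeFn_boolPair]
      simp [ones]
    · rw [decide_eq_false hch]
      simp only [Bool.false_eq_true, ↓reduceIte]
      rw [if_neg hch, Function.comp_apply, fanoutFn_apply, gOf, Function.comp_apply, fanoutFn_apply, fanoutFn_apply, h1, hpw, hpr, hps,
        gPF_apply hWlen hRlen, concatFn_boolPair]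

/-- **Value of the block piece** on a well-formed record: `posBlk`. [folklore] -/
theorem pieceBlk_apply (hlp : IsLengthPreserving f) {N t : ℕ} {τ : List (List Bool × Bool)} (hτ : ∀ q ∈ τ, q.1.length = N)
    (uc : Bool) (z pcs U Z : List Bool) (i : ℕ) :
    pieceBlk f (boolPair (srec N t τ uc z pcs U Z) (ones i)) = posBlk N τ uc z i (Greedy.blkL (cP N) i pcs) := by
  set w := boolPair (srec N t τ uc z pcs U Z) (ones i) with hw
  obtain ⟨h1, -, -, -, h5, -, -, -, -, h10, -⟩ := units_srec N t τ uc z pcs U Z i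
  obtain ⟨hpc, hrec, hfix, hchal, hpr, hps, hpu, hpw⟩ := slices_srec (t := t) hτ uc z (pcs := pcs) U Z i
  have hpLU : pLU f w = ones (pubLen N) := by
    rw [pLU, Function.comp_apply, fanoutFn_apply, Function.comp_apply, fanoutFn_apply, h1, LgU_apply hlp, h10, concatFn_boolPair,
      Com.ones_append, pubLen]
  rw [pieceBlk, iteFn_apply hfix]
  by_cases hlt : i < τ.length
  · rw [decide_eq_true hlt, if_pos rfl]
    have hwl : (τ.getD i ([], false)).1.length = N := by
      rw [List.getD_eq_getElem _ _ hlt]; exact hτ _ (List.getElem_mem hlt)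
    have hrecW : recWF w = (τ.getD i ([], false)).1 := by
      rw [recWF, Function.comp_apply, fanoutFn_apply, h1, hrec, takeFn_boolPair, length_unary, blkL_encT hτ hlt,
        List.take_append_of_le_length hwl.ge, List.take_of_length_le hwl.le]
    have hrecC : recCF w = [(τ.getD i ([], false)).2] := by
      rw [recCF, Function.comp_apply, fanoutFn_apply, h1, hrec, dropFn_boolPair, length_unary, blkL_encT hτ hlt,
        List.drop_append_of_le_length hwl.ge, List.drop_of_length_le hwl.le, List.nil_append]
    rw [iteFn_apply hrecC, posBlk, if_pos hlt]
    by_cases hc : (τ.getD i ([], false)).2 = true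
    · rw [hc, if_pos rfl, if_pos rfl, hpu]
    · rw [Bool.not_eq_true] at hc
      rw [hc]
      simp only [Bool.false_eq_true, ↓reduceIte]
      rw [glOf, Function.comp_apply, fanoutFn_apply, fanoutFn_apply, h1, hrecW, hps, glbF_apply]
  · rw [decide_eq_false hlt]
    simp only [Bool.false_eq_true, ↓reduceIte]
    rw [iteFn_apply hchal, posBlk, if_neg hlt]
    by_cases hch : uc = true ∧ i = τ.length
    · rw [decide_eq_true hch, if_pos rfl, if_pos hch, Function.comp_apply, fanoutFn_apply, hpLU, h5, dropFn_boolPair]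
      simp [ones]
    · rw [decide_eq_false hch]
      simp only [Bool.false_eq_true, ↓reduceIte]
      rw [if_neg hch, glOf, Function.comp_apply, fanoutFn_apply, fanoutFn_apply, h1, hpw, hps, glbF_apply]

/-- **The pieces are in `FP`** (for `f ∈ FP`). [Arora–Barak 2009, §1.3] [folklore] -/
theorem pieces_mem_FP (hf : f ∈ FP) : piecePub f ∈ FP ∧ pieceBlk f ∈ FP := by
  have hx : xF ∈ FP := fstF_mem_FP
  have hi : iU ∈ FP := sndF_mem_FP
  have hN : NU ∈ FP := comp_mem_FP fstF_mem_FP (comp_mem_FP fstF_mem_FP hx)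
  have htm : tmF ∈ FP := comp_mem_FP fstF_mem_FP (comp_mem_FP sndF_mem_FP hx)
  have huc : ucF ∈ FP := comp_mem_FP fstF_mem_FP (comp_mem_FP fstF_mem_FP (comp_mem_FP sndF_mem_FP (comp_mem_FP sndF_mem_FP hx)))
  have hz : zF ∈ FP := comp_mem_FP sndF_mem_FP (comp_mem_FP fstF_mem_FP (comp_mem_FP sndF_mem_FP (comp_mem_FP sndF_mem_FP hx)))
  have hpcs : pcsF ∈ FP := comp_mem_FP fstF_mem_FP (comp_mem_FP sndF_mem_FP (comp_mem_FP sndF_mem_FP (comp_mem_FP sndF_mem_FP hx)))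
  have hrl : rlU ∈ FP := comp_mem_FP (polyFn_mem_FP _) hN
  have hK : KKU ∈ FP := comp_mem_FP logFn_mem_FP hN
  have hKN : KNU ∈ FP := comp_mem_FP HashBricks.umulFn_mem_FP (fanoutFn_mem_FP hK hN)
  have hNr : NrU ∈ FP := comp_mem_FP concatFn_mem_FP (fanoutFn_mem_FP hN hrl)
  have hNrK : NrKU ∈ FP := comp_mem_FP concatFn_mem_FP (fanoutFn_mem_FP hNr hKN)
  have hcP : cPU ∈ FP := comp_mem_FP concatFn_mem_FP (fanoutFn_mem_FP hNrK hK)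
  have hn1 : n1U ∈ FP := comp_mem_FP (cons_mem_FP true) hN
  have hpL : pLU f ∈ FP := comp_mem_FP concatFn_mem_FP (fanoutFn_mem_FP (comp_mem_FP (LgU_mem_FP hf) (fanoutFn_mem_FP hN hN)) hKN)
  have hpc : pcF ∈ FP := comp_mem_FP takeFn_mem_FP (fanoutFn_mem_FP hcP (comp_mem_FP dropFn_mem_FP (fanoutFn_mem_FP
    (comp_mem_FP HashBricks.umulFn_mem_FP (fanoutFn_mem_FP hi hcP)) hpcs)))
  have hrec : recF ∈ FP := comp_mem_FP takeFn_mem_FP (fanoutFn_mem_FP hn1 (comp_mem_FP dropFn_mem_FP (fanoutFn_mem_FP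
    (comp_mem_FP HashBricks.umulFn_mem_FP (fanoutFn_mem_FP hi hn1)) htm)))
  have hfix : fixedF ∈ FP := comp_mem_FP (lenLeFn_mem_FP _) (fanoutFn_mem_FP htm (comp_mem_FP HashBricks.umulFn_mem_FP
    (fanoutFn_mem_FP (comp_mem_FP (cons_mem_FP true) hi) hn1)))
  have hle1 : le1F ∈ FP := comp_mem_FP (lenLeFn_mem_FP _) (fanoutFn_mem_FP htm (comp_mem_FP HashBricks.umulFn_mem_FP (fanoutFn_mem_FP hi hn1)))
  have hle2 : le2F ∈ FP := comp_mem_FP (lenLeFn_mem_FP _) (fanoutFn_mem_FP (comp_mem_FP HashBricks.umulFn_mem_FP (fanoutFn_mem_FP hi hn1)) htm)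
  have hchal : chalF ∈ FP := iteFn_mem_FP hle1 (iteFn_mem_FP hle2 huc (const_mem_FP _)) (const_mem_FP _)
  have hrecW : recWF ∈ FP := comp_mem_FP takeFn_mem_FP (fanoutFn_mem_FP hN hrec)
  have hrecC : recCF ∈ FP := comp_mem_FP dropFn_mem_FP (fanoutFn_mem_FP hN hrec)
  have hpr : prF ∈ FP := comp_mem_FP takeFn_mem_FP (fanoutFn_mem_FP hrl (comp_mem_FP dropFn_mem_FP (fanoutFn_mem_FP hN hpc)))
  have hps : psF ∈ FP := comp_mem_FP takeFn_mem_FP (fanoutFn_mem_FP hKN (comp_mem_FP dropFn_mem_FP (fanoutFn_mem_FP hNr hpc)))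
  have hpu : puF ∈ FP := comp_mem_FP takeFn_mem_FP (fanoutFn_mem_FP hK (comp_mem_FP dropFn_mem_FP (fanoutFn_mem_FP hNrK hpc)))
  have hpw : pwF ∈ FP := comp_mem_FP takeFn_mem_FP (fanoutFn_mem_FP hN hpc)
  have hgOf : ∀ w : List Bool → List Bool, w ∈ FP → gOf f w ∈ FP := fun w hw =>
    comp_mem_FP (gPF_mem_FP hf) (fanoutFn_mem_FP hN (fanoutFn_mem_FP hw hpr))
  have hglOf : ∀ w : List Bool → List Bool, w ∈ FP → glOf w ∈ FP := fun w hw =>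
    comp_mem_FP glbF_mem_FP (fanoutFn_mem_FP hN (fanoutFn_mem_FP hw hps))
  refine ⟨?_, ?_⟩
  · exact iteFn_mem_FP hfix (comp_mem_FP concatFn_mem_FP (fanoutFn_mem_FP (hgOf _ hrecW) hps))
      (iteFn_mem_FP hchal (comp_mem_FP takeFn_mem_FP (fanoutFn_mem_FP hpL hz)) (comp_mem_FP concatFn_mem_FP (fanoutFn_mem_FP (hgOf _ hpw) hps)))
  · exact iteFn_mem_FP hfix (iteFn_mem_FP hrecC hpu (hglOf _ hrecW))
      (iteFn_mem_FP hchal (comp_mem_FP dropFn_mem_FP (fanoutFn_mem_FP hpL hz)) (hglOf _ hpw))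

/-! #### The folds `pubs`, `blocks` and the samples -/

variable (P f kcP mlenF)

/-- `1^N` from the record `X` itself. [folklore] -/
noncomputable def NX : List Bool → List Bool := fstF ∘ fstF
/-- `⟨1^N, 1^t⟩` from `X`. [folklore] -/
noncomputable def ctxX : List Bool → List Bool := fstF
/-- `U` from `X`. [folklore] -/
noncomputable def UX : List Bool → List Bool := fstF ∘ sndF ∘ sndF ∘ sndF ∘ sndF
/-- `Z` from `X`. [folklore] -/
noncomputable def ZX : List Bool → List Bool := sndF ∘ sndF ∘ sndF ∘ sndF ∘ sndF
/-- `1^{k}` from `X` (`k = kcP³`). [folklore] -/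
noncomputable def kkX : List Bool → List Bool := polyFn (kcP ^ 3) ∘ NX
/-- `1^{k·K}` from `X`. [folklore] -/
noncomputable def kkKX : List Bool → List Bool := HashBricks.umulFn ∘ fanoutFn (kkX kcP) (logFn ∘ NX)
/-- `1^{m}` from `X` (the given program for `mlen`). [folklore] -/
noncomputable def mX : List Bool → List Bool := mlenF ∘ ctxX
/-- The initial fold record `⟨X, ⟨bin k, ⟨1⁰, ε⟩⟩⟩`. [folklore] -/
noncomputable def initF : List Bool → List Bool := fanoutFn id (fanoutFn (lenBinF ∘ kkX kcP) (fun _ => boolPair [] []))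
/-- **The program of `pubs`.** [folklore] -/
noncomputable def pubsF : List Bool → List Bool := sndPow 2 ∘ foldLoop appF (clipF 1 (piecePub f)) (kcP ^ 3) ∘ initF kcP
/-- **The program of `blocks`.** [folklore] -/
noncomputable def blocksF : List Bool → List Bool := sndPow 2 ∘ foldLoop appF (clipF 1 (pieceBlk f)) (kcP ^ 3) ∘ initF kcP
/-- **The program of a `𝒟`-sample** `X ↦ h'_U(blocks) ‖ pubs ‖ U`. [cite: HastadImpagliazzoLevinLuby1999, §6.2 eq. (8)] -/
noncomputable def DsampleF : List Bool → List Bool :=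
  concatFn ∘ fanoutFn (concatFn ∘ fanoutFn (AffineProg.hashFn ∘ fanoutFn (fanoutFn (kkKX kcP) (mX mlenF)) (fanoutFn UX (blocksF f kcP)))
    (pubsF f kcP)) UX
/-- **The program of an `ℰ`-sample** `X ↦ Z ‖ pubs ‖ U`. [cite: HastadImpagliazzoLevinLuby1999, Thm 6.2.1 (ℰ)] -/
noncomputable def EsampleF : List Bool → List Bool := concatFn ∘ fanoutFn (concatFn ∘ fanoutFn ZX (pubsF f kcP)) UX

variable {P f kcP mlenF}

/-- The parameters are the polynomial ones: `kc = kcP`, and `mlenF ⟨1^N, 1^t⟩ = 1^{mlen N t}`. [folklore] -/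
structure ProgSpec (P : Params) (kcP : Polynomial ℕ) (mlenF : List Bool → List Bool) : Prop where
  kc_eq : ∀ N, P.kc N = kcP.eval N
  mlenF_apply : ∀ N t, mlenF (boolPair (unaryEncodeNat N) (unaryEncodeNat t)) = ones (P.mlen N t)
  mlenF_mem : mlenF ∈ FP

/-- `k = (kcP³)(N)` under the spec. [folklore] -/
theorem ProgSpec.kk_eq (hS : ProgSpec P kcP mlenF) (N : ℕ) : P.kk N = (kcP ^ 3).eval N := by
  rw [kk, hS.kc_eq, Polynomial.eval_pow]

/-- Values of the record-level helpers on `srec`. [folklore] -/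
theorem unitsX_srec (hS : ProgSpec P kcP mlenF) (N t : ℕ) (τ : List (List Bool × Bool)) (uc : Bool) (z pcs U Z : List Bool) :
    NX (srec N t τ uc z pcs U Z) = unaryEncodeNat N ∧ UX (srec N t τ uc z pcs U Z) = U ∧ ZX (srec N t τ uc z pcs U Z) = Z ∧
      kkX kcP (srec N t τ uc z pcs U Z) = ones (P.kk N) ∧ kkKX kcP (srec N t τ uc z pcs U Z) = ones (P.kk N * kL N) ∧
      mX mlenF (srec N t τ uc z pcs U Z) = ones (P.mlen N t) := by
  have hN := length_unary N
  have h1 : NX (srec N t τ uc z pcs U Z) = unaryEncodeNat N := by simp [NX, srec]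
  have h2 : UX (srec N t τ uc z pcs U Z) = U := by simp [UX, srec]
  have h3 : ZX (srec N t τ uc z pcs U Z) = Z := by simp [ZX, srec]
  have h4 : kkX kcP (srec N t τ uc z pcs U Z) = ones (P.kk N) := by rw [kkX, Function.comp_apply, h1, polyFn_apply, hN, hS.kk_eq]
  have h5 : kkKX kcP (srec N t τ uc z pcs U Z) = ones (P.kk N * kL N) := by
    rw [kkKX, Function.comp_apply, fanoutFn_apply, h4, Function.comp_apply, h1, HashBricks.umulFn_apply, fstF_boolPair, sndF_boolPair,
      logFn, hN, kL]; simp [ones]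
  have h6 : mX mlenF (srec N t τ uc z pcs U Z) = ones (P.mlen N t) := by
    rw [mX, Function.comp_apply, ctxX, srec, fstF_boolPair, hS.mlenF_apply]
  exact ⟨h1, h2, h3, h4, h5, h6⟩

/-- The record is long: `2|pcs| + 4N + 22 ≤ |srec|`. [folklore] -/
theorem le_length_srec (N t : ℕ) (τ : List (List Bool × Bool)) (uc : Bool) (z pcs U Z : List Bool) :
    2 * pcs.length + 4 * N + 22 ≤ (srec N t τ uc z pcs U Z).length := by
  have hN := length_unary N
  simp only [srec, length_boolPair, hN, List.length_singleton]
  omega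

set_option maxHeartbeats 800000 in
/-- **Value of `pubsF`** on a well-formed record (`1 ≤ kc N`). [folklore] -/
theorem pubsF_apply (hS : ProgSpec P kcP mlenF) (hlp : IsLengthPreserving f) {N t : ℕ} (hk : 1 ≤ P.kc N)
    {τ : List (List Bool × Bool)} (hτ : ∀ q ∈ τ, q.1.length = N) (uc : Bool) {z : List Bool} (hz : uc = true → z.length = La N)
    {pcs : List Bool} (hpcs : pcs.length = P.kk N * cP N) (U Z : List Bool) :
    pubsF f kcP (srec N t τ uc z pcs U Z) = P.pubs f N τ uc z pcs := by
  obtain ⟨-, -, -, h4, -, -⟩ := unitsX_srec hS N t τ uc z pcs U Z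
  have hkk1 : 1 ≤ P.kk N := Nat.one_le_pow _ _ hk
  have hlen := le_length_srec N t τ uc z pcs U Z
  have hinit : initF kcP (srec N t τ uc z pcs U Z) = boolPair (srec N t τ uc z pcs U Z) (boolPair (encodeNat (P.kk N)) (boolPair (ones 0) [])) := by
    rw [initF, fanoutFn_apply, fanoutFn_apply, id, Function.comp_apply, h4, lenBinF_apply]; simp [ones]
  have hkM : P.kk N ≤ (kcP ^ 3).eval (srec N t τ uc z pcs U Z).length := by
    rw [hS.kk_eq]; exact TM2Iter.eval_mono _ (by omega)
  have hcP_le : pubLen N ≤ (srec N t τ uc z pcs U Z).length + 1 := by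
    have h2 : cP N ≤ pcs.length := by rw [hpcs]; exact Nat.le_mul_of_pos_left _ hkk1
    have h3 : pubLen N ≤ cP N + (2 * N + 6) := by
      have := hLen_le N
      have := nLen_add_ibLen N
      unfold pubLen cP Lg; omega
    omega
  have hpieces : ∀ j, 0 ≤ j → j < 0 + P.kk N →
      (piecePub f (boolPair (srec N t τ uc z pcs U Z) (ones j))).length ≤ 1 * ((srec N t τ uc z pcs U Z).length + 1) := by
    intro j _ hj
    rw [piecePub_apply hlp hτ uc z hpcs U Z (by omega), one_mul, length_posPub hlp hτ hz j (length_blkL hpcs (by omega))]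
    exact hcP_le
  rw [pubsF, Function.comp_apply, Function.comp_apply, hinit, foldLoop_apply _ _ hkM 0, sndPow_succ_boolPair, sndPow_succ_boolPair,
    sndPow_zero_boolPair, foldAcc_clipF hpieces, foldAcc_appF, List.nil_append, Hybrid.ccat_eq_flatten_range, pubs]
  exact congrArg List.flatten (List.map_congr_left fun i hi => by rw [zero_add, piecePub_apply hlp hτ uc z hpcs U Z (List.mem_range.1 hi)])

set_option maxHeartbeats 800000 in
/-- **Value of `blocksF`** on a well-formed record. [folklore] -/
theorem blocksF_apply (hS : ProgSpec P kcP mlenF) (hlp : IsLengthPreserving f) {N t : ℕ}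
    {τ : List (List Bool × Bool)} (hτ : ∀ q ∈ τ, q.1.length = N) (uc : Bool) {z : List Bool} (hz : uc = true → z.length = La N)
    {pcs : List Bool} (hpcs : pcs.length = P.kk N * cP N) (U Z : List Bool) :
    blocksF f kcP (srec N t τ uc z pcs U Z) = P.blocks N τ uc z pcs := by
  obtain ⟨-, -, -, h4, -, -⟩ := unitsX_srec hS N t τ uc z pcs U Z
  have hlen := le_length_srec N t τ uc z pcs U Z
  have hinit : initF kcP (srec N t τ uc z pcs U Z) = boolPair (srec N t τ uc z pcs U Z) (boolPair (encodeNat (P.kk N)) (boolPair (ones 0) [])) := by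
    rw [initF, fanoutFn_apply, fanoutFn_apply, id, Function.comp_apply, h4, lenBinF_apply]; simp [ones]
  have hkM : P.kk N ≤ (kcP ^ 3).eval (srec N t τ uc z pcs U Z).length := by
    rw [hS.kk_eq]; exact TM2Iter.eval_mono _ (by omega)
  have hKle : kL N ≤ (srec N t τ uc z pcs U Z).length + 1 := (kL_le N).trans (by omega)
  have hpieces : ∀ j, 0 ≤ j → j < 0 + P.kk N →
      (pieceBlk f (boolPair (srec N t τ uc z pcs U Z) (ones j))).length ≤ 1 * ((srec N t τ uc z pcs U Z).length + 1) := by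
    intro j _ hj
    rw [pieceBlk_apply hlp hτ uc z pcs U Z j, one_mul, length_posBlk hz j (length_blkL hpcs (by omega))]
    exact hKle
  rw [blocksF, Function.comp_apply, Function.comp_apply, hinit, foldLoop_apply _ _ hkM 0, sndPow_succ_boolPair, sndPow_succ_boolPair,
    sndPow_zero_boolPair, foldAcc_clipF hpieces, foldAcc_appF, List.nil_append, Hybrid.ccat_eq_flatten_range, blocks]
  exact congrArg List.flatten (List.map_congr_left fun i _ => by rw [zero_add, pieceBlk_apply hlp hτ uc z pcs U Z i])

/-- **Value of `DsampleF`.** [folklore] -/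
theorem DsampleF_apply (hS : ProgSpec P kcP mlenF) (hlp : IsLengthPreserving f) {N t : ℕ} (hk : 1 ≤ P.kc N)
    {τ : List (List Bool × Bool)} (hτ : ∀ q ∈ τ, q.1.length = N) (uc : Bool) {z : List Bool} (hz : uc = true → z.length = La N)
    {pcs : List Bool} (hpcs : pcs.length = P.kk N * cP N) (U Z : List Bool) :
    DsampleF f kcP mlenF (srec N t τ uc z pcs U Z) = P.Dsample f N t τ uc z pcs U := by
  obtain ⟨-, h2, -, -, h5, h6⟩ := unitsX_srec hS N t τ uc z pcs U Z
  rw [DsampleF, Function.comp_apply, fanoutFn_apply, Function.comp_apply, fanoutFn_apply, Function.comp_apply, fanoutFn_apply, fanoutFn_apply,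
    fanoutFn_apply, h5, h6, h2, blocksF_apply hS hlp hτ uc hz hpcs U Z, AffineProg.hashFn_boolPair, pubsF_apply hS hlp hk hτ uc hz hpcs U Z,
    concatFn_boolPair, concatFn_boolPair, Dsample]

/-- **Value of `EsampleF`.** [folklore] -/
theorem EsampleF_apply (hS : ProgSpec P kcP mlenF) (hlp : IsLengthPreserving f) {N t : ℕ} (hk : 1 ≤ P.kc N)
    {τ : List (List Bool × Bool)} (hτ : ∀ q ∈ τ, q.1.length = N) (uc : Bool) {z : List Bool} (hz : uc = true → z.length = La N)
    {pcs : List Bool} (hpcs : pcs.length = P.kk N * cP N) (U Z : List Bool) :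
    EsampleF f kcP (srec N t τ uc z pcs U Z) = P.Esample f N τ uc z pcs U Z := by
  obtain ⟨-, h2, h3, -⟩ := unitsX_srec hS N t τ uc z pcs U Z
  rw [EsampleF, Function.comp_apply, fanoutFn_apply, Function.comp_apply, fanoutFn_apply, h3, h2, pubsF_apply hS hlp hk hτ uc hz hpcs U Z,
    concatFn_boolPair, concatFn_boolPair, Esample]

set_option maxHeartbeats 800000 in
/-- **The sample programs are in `FP`** (for `f ∈ FP` and an `FP` program for `mlen`). [Arora–Barak 2009, §1.3–1.4] [folklore] -/
theorem samples_mem_FP (hS : ProgSpec P kcP mlenF) (hf : f ∈ FP) :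
    pubsF f kcP ∈ FP ∧ blocksF f kcP ∈ FP ∧ DsampleF f kcP mlenF ∈ FP ∧ EsampleF f kcP ∈ FP := by
  obtain ⟨hpp, hpb⟩ := pieces_mem_FP (f := f) hf
  have hNX : NX ∈ FP := comp_mem_FP fstF_mem_FP fstF_mem_FP
  have hUX : UX ∈ FP := comp_mem_FP fstF_mem_FP (comp_mem_FP sndF_mem_FP (comp_mem_FP sndF_mem_FP (comp_mem_FP sndF_mem_FP sndF_mem_FP)))
  have hZX : ZX ∈ FP := comp_mem_FP sndF_mem_FP (comp_mem_FP sndF_mem_FP (comp_mem_FP sndF_mem_FP (comp_mem_FP sndF_mem_FP sndF_mem_FP)))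
  have hkk : kkX kcP ∈ FP := comp_mem_FP (polyFn_mem_FP _) hNX
  have hkkK : kkKX kcP ∈ FP := comp_mem_FP HashBricks.umulFn_mem_FP (fanoutFn_mem_FP hkk (comp_mem_FP logFn_mem_FP hNX))
  have hm : mX mlenF ∈ FP := comp_mem_FP hS.mlenF_mem fstF_mem_FP
  have hinit : initF kcP ∈ FP := fanoutFn_mem_FP (PolyTimeComputable.id _) (fanoutFn_mem_FP (comp_mem_FP lenBinF_mem_FP hkk) (const_mem_FP _))
  have hpubs : pubsF f kcP ∈ FP := comp_mem_FP (sndPow_mem_FP 2) (comp_mem_FP (foldLoop_clipF_mem_FP 1 appF_mem_FP length_appF_le hpp _) hinit)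
  have hblocks : blocksF f kcP ∈ FP := comp_mem_FP (sndPow_mem_FP 2) (comp_mem_FP (foldLoop_clipF_mem_FP 1 appF_mem_FP length_appF_le hpb _) hinit)
  refine ⟨hpubs, hblocks, ?_, ?_⟩
  · exact comp_mem_FP concatFn_mem_FP (fanoutFn_mem_FP (comp_mem_FP concatFn_mem_FP (fanoutFn_mem_FP
      (comp_mem_FP AffineProg.hashFn_mem_FP (fanoutFn_mem_FP (fanoutFn_mem_FP hkkK hm) (fanoutFn_mem_FP hUX hblocks))) hpubs)) hUX)
  · exact comp_mem_FP concatFn_mem_FP (fanoutFn_mem_FP (comp_mem_FP concatFn_mem_FP (fanoutFn_mem_FP hZX hpubs)) hUX)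

/-! #### Running `A` on a sample read off a coin string -/

variable (P f kcP mlenF) (A : RandAlg (List Bool) Bool)

/-- **The context record** `Y = ⟨⟨1^N, 1^t⟩, ⟨tmpl, ⟨[uc], z⟩⟩⟩` (what the machine holds; the coins come separately). [folklore] -/
def yrec (N t : ℕ) (τ : List (List Bool × Bool)) (uc : Bool) (z : List Bool) : List Bool :=
  boolPair (boolPair (unaryEncodeNat N) (unaryEncodeNat t)) (boolPair (encT τ) (boolPair [uc] z))

/-- `1^{k·cP}` from `⟨Y, r⟩`. [folklore] -/
noncomputable def kkcPU : List Bool → List Bool := HashBricks.umulFn ∘ fanoutFn (polyFn (kcP ^ 3) ∘ NU) cPU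
/-- `1^{m}` from `⟨Y, r⟩`. [folklore] -/
noncomputable def mlU : List Bool → List Bool := mlenF ∘ fstF ∘ fstF
/-- `1^{uLen}` from `⟨Y, r⟩`. [folklore] -/
noncomputable def uLU : List Bool → List Bool :=
  HashBricks.umulFn ∘ fanoutFn (List.cons true ∘ HashBricks.umulFn ∘ fanoutFn (polyFn (kcP ^ 3) ∘ NU) KKU) (mlU mlenF)
/-- `pcs = r ↾ k·cP`. [folklore] -/
noncomputable def pcsR : List Bool → List Bool := takeFn ∘ fanoutFn (kkcPU kcP) sndF
/-- `r ⇂ k·cP`. [folklore] -/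
noncomputable def r1R : List Bool → List Bool := dropFn ∘ fanoutFn (kkcPU kcP) sndF
/-- `U`. [folklore] -/
noncomputable def UR : List Bool → List Bool := takeFn ∘ fanoutFn (uLU kcP mlenF) (r1R kcP)
/-- `r ⇂ (k·cP + uLen)`. [folklore] -/
noncomputable def r2R : List Bool → List Bool := dropFn ∘ fanoutFn (uLU kcP mlenF) (r1R kcP)
/-- `Z` (for `ℰ`). [folklore] -/
noncomputable def ZR : List Bool → List Bool := takeFn ∘ fanoutFn (mlU mlenF) (r2R kcP mlenF)
/-- `A`'s coins for `ℰ`. [folklore] -/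
noncomputable def r3R : List Bool → List Bool := dropFn ∘ fanoutFn (mlU mlenF) (r2R kcP mlenF)
/-- The sampler record assembled for `𝒟`. [folklore] -/
noncomputable def XDR : List Bool → List Bool :=
  fanoutFn (fstF ∘ fstF) (fanoutFn (fstF ∘ sndF ∘ fstF) (fanoutFn (sndF ∘ sndF ∘ fstF)
    (fanoutFn (pcsR kcP) (fanoutFn (UR kcP mlenF) (fun _ => [])))))
/-- The sampler record assembled for `ℰ`. [folklore] -/
noncomputable def XER : List Bool → List Bool :=
  fanoutFn (fstF ∘ fstF) (fanoutFn (fstF ∘ sndF ∘ fstF) (fanoutFn (sndF ∘ sndF ∘ fstF)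
    (fanoutFn (pcsR kcP) (fanoutFn (UR kcP mlenF) (ZR kcP mlenF)))))
/-- **`⟨Y, r⟩ ↦ [A(1^N, 𝒟-sample)]`.** [cite: HastadImpagliazzoLevinLuby1999, Lemma 6.3.2 (proof: "run A on …")] -/
noncomputable def runDF : List Bool → List Bool :=
  (fun q => encodeBool (A.run (fstF q) (sndF q))) ∘ fanoutFn (fanoutFn NU (DsampleF f kcP mlenF ∘ XDR kcP mlenF)) (r2R kcP mlenF)
/-- **`⟨Y, r⟩ ↦ [A(1^N, ℰ-sample)]`.** [cite: HastadImpagliazzoLevinLuby1999, Lemma 6.3.2 (proof)] -/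
noncomputable def runEF : List Bool → List Bool :=
  (fun q => encodeBool (A.run (fstF q) (sndF q))) ∘ fanoutFn (fanoutFn NU (EsampleF f kcP ∘ XER kcP mlenF)) (r3R kcP mlenF)

variable {P f kcP mlenF A}

set_option maxHeartbeats 800000 in
/-- Values of the coin-splitting helpers on `⟨Y, r⟩`. [folklore] -/
theorem unitsR (hS : ProgSpec P kcP mlenF) (N t : ℕ) (τ : List (List Bool × Bool)) (uc : Bool) (z r : List Bool) :
    let q := boolPair (yrec N t τ uc z) r
    NU q = unaryEncodeNat N ∧ kkcPU kcP q = ones (P.kk N * cP N) ∧ mlU mlenF q = ones (P.mlen N t) ∧ uLU kcP mlenF q = ones (P.uLen N t) ∧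
      pcsR kcP q = r.take (P.kk N * cP N) ∧ r1R kcP q = r.drop (P.kk N * cP N) ∧
      UR kcP mlenF q = (r.drop (P.kk N * cP N)).take (P.uLen N t) ∧ r2R kcP mlenF q = (r.drop (P.kk N * cP N)).drop (P.uLen N t) ∧
      ZR kcP mlenF q = ((r.drop (P.kk N * cP N)).drop (P.uLen N t)).take (P.mlen N t) ∧
      r3R kcP mlenF q = ((r.drop (P.kk N * cP N)).drop (P.uLen N t)).drop (P.mlen N t) := by
  intro q
  have hN := length_unary N
  -- the accessors `NU`, `KKU`, `cPU` only read `1^N`, which sits at the same place as in a sampler record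
  obtain ⟨h1, -, -, -, -, -, -, -, h9, -, -, -, h13, -⟩ := units_srec N t τ uc z [] [] [] 0
  have hNU : NU q = unaryEncodeNat N := by simp [q, NU, xF, yrec]
  have hKKU : KKU q = ones (kL N) := by rw [KKU, Function.comp_apply, hNU, logFn, hN, kL]
  have hcPU : cPU q = ones (cP N) := by
    have e1 : cPU q = cPU (boolPair (srec N t τ uc z [] [] []) (ones 0)) := by
      simp only [cPU, NrKU, NrU, KNU, KKU, rlU, NU, xF, Function.comp_apply, fanoutFn_apply, q, yrec, srec, fstF_boolPair]
    rw [e1, h13]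
  have hkk : kkcPU kcP q = ones (P.kk N * cP N) := by
    rw [kkcPU, Function.comp_apply, fanoutFn_apply, Function.comp_apply, hNU, polyFn_apply, hN, ← hS.kk_eq, hcPU, HashBricks.umulFn_apply,
      fstF_boolPair, sndF_boolPair]; simp [ones]
  have hml : mlU mlenF q = ones (P.mlen N t) := by
    rw [mlU, Function.comp_apply, Function.comp_apply]; simp only [q, yrec, fstF_boolPair]; exact hS.mlenF_apply N t
  have huL : uLU kcP mlenF q = ones (P.uLen N t) := by
    rw [uLU, Function.comp_apply, fanoutFn_apply, Function.comp_apply, Function.comp_apply, fanoutFn_apply, Function.comp_apply, hNU,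
      polyFn_apply, hN, ← hS.kk_eq, hKKU, HashBricks.umulFn_apply, fstF_boolPair, sndF_boolPair, hml, HashBricks.umulFn_apply,
      fstF_boolPair, sndF_boolPair, uLen]
    simp [ones]
  have hpcs : pcsR kcP q = r.take (P.kk N * cP N) := by rw [pcsR, Function.comp_apply, fanoutFn_apply, hkk]; simp [q, ones]
  have hr1 : r1R kcP q = r.drop (P.kk N * cP N) := by rw [r1R, Function.comp_apply, fanoutFn_apply, hkk]; simp [q, ones]
  have hU : UR kcP mlenF q = (r.drop (P.kk N * cP N)).take (P.uLen N t) := by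
    rw [UR, Function.comp_apply, fanoutFn_apply, huL, hr1, takeFn_boolPair]; simp [ones]
  have hr2 : r2R kcP mlenF q = (r.drop (P.kk N * cP N)).drop (P.uLen N t) := by
    rw [r2R, Function.comp_apply, fanoutFn_apply, huL, hr1, dropFn_boolPair]; simp [ones]
  have hZ : ZR kcP mlenF q = ((r.drop (P.kk N * cP N)).drop (P.uLen N t)).take (P.mlen N t) := by
    rw [ZR, Function.comp_apply, fanoutFn_apply, hml, hr2, takeFn_boolPair]; simp [ones]
  have hr3 : r3R kcP mlenF q = ((r.drop (P.kk N * cP N)).drop (P.uLen N t)).drop (P.mlen N t) := by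
    rw [r3R, Function.comp_apply, fanoutFn_apply, hml, hr2, dropFn_boolPair]; simp [ones]
  exact ⟨hNU, hkk, hml, huL, hpcs, hr1, hU, hr2, hZ, hr3⟩

/-- **Value of `runDF`**: `[runD … r]`. [folklore] -/
theorem runDF_apply (hS : ProgSpec P kcP mlenF) (hlp : IsLengthPreserving f) {N t : ℕ} (hk : 1 ≤ P.kc N)
    {τ : List (List Bool × Bool)} (hτ : ∀ q ∈ τ, q.1.length = N) (uc : Bool) {z : List Bool} (hz : uc = true → z.length = La N)
    {r : List Bool} (hr : P.kk N * cP N ≤ r.length) :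
    runDF f kcP mlenF A (boolPair (yrec N t τ uc z) r) = encodeBool (P.runD f A N t τ uc z r) := by
  obtain ⟨hNU, -, -, -, hpcs, -, hU, hr2, -, -⟩ := unitsR hS N t τ uc z r
  have hX : XDR kcP mlenF (boolPair (yrec N t τ uc z) r) =
      srec N t τ uc z (r.take (P.kk N * cP N)) ((r.drop (P.kk N * cP N)).take (P.uLen N t)) [] := by
    rw [XDR, fanoutFn_apply, fanoutFn_apply, fanoutFn_apply, fanoutFn_apply, fanoutFn_apply, hpcs, hU]
    simp [yrec, srec]
  have hpl : (r.take (P.kk N * cP N)).length = P.kk N * cP N := by rw [List.length_take]; exact min_eq_left hr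
  rw [runDF, Function.comp_apply, fanoutFn_apply, fanoutFn_apply, hNU, Function.comp_apply, hX, hr2,
    DsampleF_apply hS hlp hk hτ uc hz hpl _ _, fstF_boolPair, sndF_boolPair, runD, List.drop_drop]

/-- **Value of `runEF`**: `[runE … r]`. [folklore] -/
theorem runEF_apply (hS : ProgSpec P kcP mlenF) (hlp : IsLengthPreserving f) {N t : ℕ} (hk : 1 ≤ P.kc N)
    {τ : List (List Bool × Bool)} (hτ : ∀ q ∈ τ, q.1.length = N) (uc : Bool) {z : List Bool} (hz : uc = true → z.length = La N)
    {r : List Bool} (hr : P.kk N * cP N ≤ r.length) :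
    runEF f kcP mlenF A (boolPair (yrec N t τ uc z) r) = encodeBool (P.runE f A N t τ uc z r) := by
  obtain ⟨hNU, -, -, -, hpcs, -, hU, -, hZ, hr3⟩ := unitsR hS N t τ uc z r
  have hX : XER kcP mlenF (boolPair (yrec N t τ uc z) r) =
      srec N t τ uc z (r.take (P.kk N * cP N)) ((r.drop (P.kk N * cP N)).take (P.uLen N t))
        (((r.drop (P.kk N * cP N)).drop (P.uLen N t)).take (P.mlen N t)) := by
    rw [XER, fanoutFn_apply, fanoutFn_apply, fanoutFn_apply, fanoutFn_apply, fanoutFn_apply, hpcs, hU, hZ]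
    simp [yrec, srec]
  have hpl : (r.take (P.kk N * cP N)).length = P.kk N * cP N := by rw [List.length_take]; exact min_eq_left hr
  rw [runEF, Function.comp_apply, fanoutFn_apply, fanoutFn_apply, hNU, Function.comp_apply, hX, hr3,
    EsampleF_apply hS hlp hk hτ uc hz hpl _ _, fstF_boolPair, sndF_boolPair, runE, List.drop_drop, List.drop_drop, Nat.add_assoc]

set_option maxHeartbeats 800000 in
/-- **The run programs are in `FP`** for PPT `A`. [Arora–Barak 2009, §1.3–1.4] [folklore] -/
theorem runs_mem_FP (hS : ProgSpec P kcP mlenF) (hf : f ∈ FP) (hA : IsPPT A encodeBool) :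
    runDF f kcP mlenF A ∈ FP ∧ runEF f kcP mlenF A ∈ FP := by
  obtain ⟨-, -, hDs, hEs⟩ := samples_mem_FP (f := f) hS hf
  have hdist := Hybrid.distFn_mem_FP hA
  have hN : NU ∈ FP := comp_mem_FP fstF_mem_FP (comp_mem_FP fstF_mem_FP fstF_mem_FP)
  have hrl : rlU ∈ FP := comp_mem_FP (polyFn_mem_FP _) hN
  have hK : KKU ∈ FP := comp_mem_FP logFn_mem_FP hN
  have hKN : KNU ∈ FP := comp_mem_FP HashBricks.umulFn_mem_FP (fanoutFn_mem_FP hK hN)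
  have hNr : NrU ∈ FP := comp_mem_FP concatFn_mem_FP (fanoutFn_mem_FP hN hrl)
  have hNrK : NrKU ∈ FP := comp_mem_FP concatFn_mem_FP (fanoutFn_mem_FP hNr hKN)
  have hcP : cPU ∈ FP := comp_mem_FP concatFn_mem_FP (fanoutFn_mem_FP hNrK hK)
  have hkkN : (polyFn (kcP ^ 3) ∘ NU) ∈ FP := comp_mem_FP (polyFn_mem_FP _) hN
  have hkk : kkcPU kcP ∈ FP := comp_mem_FP HashBricks.umulFn_mem_FP (fanoutFn_mem_FP hkkN hcP)
  have hml : mlU mlenF ∈ FP := comp_mem_FP hS.mlenF_mem (comp_mem_FP fstF_mem_FP fstF_mem_FP)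
  have huL : uLU kcP mlenF ∈ FP := comp_mem_FP HashBricks.umulFn_mem_FP (fanoutFn_mem_FP
    (comp_mem_FP (cons_mem_FP true) (comp_mem_FP HashBricks.umulFn_mem_FP (fanoutFn_mem_FP hkkN hK))) hml)
  have hpcs : pcsR kcP ∈ FP := comp_mem_FP takeFn_mem_FP (fanoutFn_mem_FP hkk sndF_mem_FP)
  have hr1 : r1R kcP ∈ FP := comp_mem_FP dropFn_mem_FP (fanoutFn_mem_FP hkk sndF_mem_FP)
  have hU : UR kcP mlenF ∈ FP := comp_mem_FP takeFn_mem_FP (fanoutFn_mem_FP huL hr1)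
  have hr2 : r2R kcP mlenF ∈ FP := comp_mem_FP dropFn_mem_FP (fanoutFn_mem_FP huL hr1)
  have hZ : ZR kcP mlenF ∈ FP := comp_mem_FP takeFn_mem_FP (fanoutFn_mem_FP hml hr2)
  have hr3 : r3R kcP mlenF ∈ FP := comp_mem_FP dropFn_mem_FP (fanoutFn_mem_FP hml hr2)
  have hc1 : (fstF ∘ fstF : List Bool → List Bool) ∈ FP := comp_mem_FP fstF_mem_FP fstF_mem_FP
  have hc2 : (fstF ∘ sndF ∘ fstF : List Bool → List Bool) ∈ FP := comp_mem_FP fstF_mem_FP (comp_mem_FP sndF_mem_FP fstF_mem_FP)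
  have hc3 : (sndF ∘ sndF ∘ fstF : List Bool → List Bool) ∈ FP := comp_mem_FP sndF_mem_FP (comp_mem_FP sndF_mem_FP fstF_mem_FP)
  have hXD : XDR kcP mlenF ∈ FP := fanoutFn_mem_FP hc1 (fanoutFn_mem_FP hc2 (fanoutFn_mem_FP hc3 (fanoutFn_mem_FP hpcs (fanoutFn_mem_FP hU (const_mem_FP _)))))
  have hXE : XER kcP mlenF ∈ FP := fanoutFn_mem_FP hc1 (fanoutFn_mem_FP hc2 (fanoutFn_mem_FP hc3 (fanoutFn_mem_FP hpcs (fanoutFn_mem_FP hU hZ))))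
  exact ⟨comp_mem_FP hdist (fanoutFn_mem_FP (fanoutFn_mem_FP hN (comp_mem_FP hDs hXD)) hr2),
    comp_mem_FP hdist (fanoutFn_mem_FP (fanoutFn_mem_FP hN (comp_mem_FP hEs hXE)) hr3)⟩

end Program

end Params

end GH

end HILL

end Literature.Computability.Cryptography
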